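import Literature.Analysis.OperatorTheory.KernelCyclicPeeling
import Literature.Analysis.OperatorTheory.CyclicKernelSpectralBound
import Literature.Analysis.OperatorTheory.ConnectedRatioBounds
import HarnessLib

/-!
# Exponential clustering of cyclic positive-kernel chains, uniformly in the period — PROVED

Topic `Literature/Analysis/OperatorTheory`; the transfer-operator theorem for PERIODIC boundary
conditions. For a bounded, jointly measurable, symmetric, strictly positive kernel `K` on a
probability space `(X, μ)` and the Gibbs state on the cycle of `N` sites with weight
`∏_{t} K(V t, V (t+1))`, the normalised connected correlation of bounded one-site observables `F` at
site `0` and `G` at site `n ≤ N/2` is at most `C₀ ‖F‖_∞ ‖G‖_∞ e^{−c n}` with `c > 0` and `C₀`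
INDEPENDENT OF THE PERIOD `N` (`exists_cyclic_clustering`, **main**; `exists_cyclic_clustering_zmod`
is the same with the cycle indexed by `ZMod N`, the form produced by time-slicing a periodic lattice).
Proof: the trace formula `KernelCyclicPeeling.integral_cyclic_eq_integral_iterate` writes the four
cyclic integrals as `∫ F(x) (κ^[n] (G · κ^[N-n-1] K(x,·)))(x) dμ`; the rank-one asymptotics
`CyclicKernelSpectralBound.exists_iterate_spectral_bound` (Jentzsch's gap `θ < λ` of the compact
self-adjoint positivity-improving transfer operator) give `λ^N α_F α_G + O(λ^N (θ/λ)^n)` etc.; for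
periods where the vacuum term dominates the partition function the perturbative bound
`ConnectedRatioBounds.abs_div_sub_div_mul_div_le_of_approx` yields the rate `c = log(λ/θ)`, the remaining short periods
are absorbed by the a-priori bound `|⟨FG⟩ − ⟨F⟩⟨G⟩| ≤ 2‖F‖‖G‖`. This is the mechanism behind
"the transfer matrix of a finite system has a gap, hence time correlations decay exponentially,
uniformly in the temporal extent" (e.g. for lattice gauge theories on a fixed spatial lattice).
Mathlib + the companions only; no definitions. [folklore]
-/

noncomputable section

open MeasureTheory Set Filter Function
open scoped RealInnerProductSpace ENNReal

namespace Literature.Analysis.OperatorTheory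

variable {X : Type*} [MeasurableSpace X] {μ : Measure X}

section Clustering

variable [IsProbabilityMeasure μ] {K : X → X → ℝ} {C : ℝ}

/-- The trace formula of `KernelCyclicPeeling` for a SYMMETRIC kernel, with the closing arc written
through the section `K(x, ·)`. [folklore] -/
theorem integral_cyclic_eq_integral_iterate_symm (hK : Measurable (uncurry K))
    (hC : ∀ x y, ‖K x y‖ ≤ C) (hsymm : ∀ x y, K x y = K y x) (k n' : ℕ) {F G : X → ℝ}
    (hF : Measurable F) (hG : Measurable G) {BF BG : ℝ} (hFb : ∀ y, ‖F y‖ ≤ BF)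
    (hGb : ∀ y, ‖G y‖ ≤ BG) (p : Fin (k + 1 + n' + 1)) (hp : (p : ℕ) = n' + 1) :
    ∫ V : Fin (k + 1 + n' + 1) → X, F (V 0) * G (V p) * ∏ t, K (V t) (V (t + 1))
        ∂(Measure.pi fun _ => μ) =
      ∫ x, F x * (fun f : X → ℝ => fun w => ∫ z, K w z * f z ∂μ)^[n' + 1]
        (fun y => G y * (fun f : X → ℝ => fun w => ∫ z, K w z * f z ∂μ)^[k] (K x) y) x ∂μ := by
  have hflip : flip K = K := funext fun a => funext fun b => hsymm b a
  have h : ∫ V : Fin (k + 1 + n' + 1) → X, F (V 0) * G (V p) * ∏ t, K (V t) (V (t + 1))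
        ∂(Measure.pi fun _ => μ) =
      ∫ x, F x * (fun f : X → ℝ => fun w => ∫ z, K w z * f z ∂μ)^[n' + 1]
        (fun y => G y * (fun f : X → ℝ => fun w => ∫ z, K w z * f z ∂μ)^[k] (flip K x) y) x ∂μ :=
    integral_cyclic_eq_integral_iterate hK hC k n' hF hG hFb hGb p hp
  rw [hflip] at h
  exact h

/-- The vacuum two-arc integrand `x ↦ (κ^[m] (κ^[k] K(x, ·)))(x)` is measurable. [folklore] -/
theorem measurable_iterate_iterate_section (hK : StronglyMeasurable (uncurry K)) (m k : ℕ) :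
    Measurable fun x => (fun f : X → ℝ => fun w => ∫ z, K w z * f z ∂μ)^[m]
      ((fun f : X → ℝ => fun w => ∫ z, K w z * f z ∂μ)^[k] (K x)) x := by
  have h1 := stronglyMeasurable_uncurry_iterate_kernel (μ := μ) hK hK k
  have h2 := stronglyMeasurable_uncurry_iterate_kernel (μ := μ) hK h1 m
  exact h2.measurable.comp (measurable_id.prodMk measurable_id)

omit [IsProbabilityMeasure μ] in
/-- Integrating a uniform pointwise approximation against a bounded weight on a probability space:
`|∫ F J − ∫ F M| ≤ ‖F‖_∞ e` if `|J − M| ≤ e` pointwise. [folklore] -/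
theorem abs_integral_mul_sub_integral_mul_le [IsProbabilityMeasure μ] {F J M : X → ℝ}
    (hF : Measurable F) (hJ : Measurable J) (hM : Measurable M) {BF BM e : ℝ}
    (hFb : ∀ x, ‖F x‖ ≤ BF) (hMb : ∀ x, ‖M x‖ ≤ BM) (hJM : ∀ x, |J x - M x| ≤ e) :
    |∫ x, F x * J x ∂μ - ∫ x, F x * M x ∂μ| ≤ BF * e := by
  have hJb : ∀ x, ‖J x‖ ≤ BM + e := fun x => by
    have h1 : |J x| ≤ |M x| + |J x - M x| := by
      have := abs_add_le (M x) (J x - M x); rwa [add_sub_cancel] at this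
    rw [Real.norm_eq_abs]
    exact h1.trans (add_le_add (by simpa [Real.norm_eq_abs] using hMb x) (hJM x))
  have hiJ : Integrable (fun x => F x * J x) μ :=
    Integrable.of_bound (hF.mul hJ).aestronglyMeasurable (BF * (BM + e))
      (Eventually.of_forall fun x => by
        rw [norm_mul]
        exact mul_le_mul (hFb x) (hJb x) (norm_nonneg _) ((norm_nonneg _).trans (hFb x)))
  have hiM : Integrable (fun x => F x * M x) μ :=
    Integrable.of_bound (hF.mul hM).aestronglyMeasurable (BF * BM)
      (Eventually.of_forall fun x => by
        rw [norm_mul]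
        exact mul_le_mul (hFb x) (hMb x) (norm_nonneg _) ((norm_nonneg _).trans (hFb x)))
  rw [← integral_sub hiJ hiM]
  have h := norm_integral_le_of_norm_le_const (μ := μ) (f := fun x => F x * J x - F x * M x)
    (C := BF * e) (Eventually.of_forall fun x => by
      rw [← mul_sub, norm_mul, Real.norm_eq_abs (J x - M x)]
      exact mul_le_mul (hFb x) (hJM x) (abs_nonneg _) ((norm_nonneg _).trans (hFb x)))
  rwa [probReal_univ, mul_one, Real.norm_eq_abs] at h

/-- **Exponential clustering of a cyclic kernel chain, uniformly in the period (transfer-operator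
gap for periodic boundary conditions).** Let `K` be a bounded, jointly measurable, symmetric,
strictly positive kernel on a probability space `(X, μ)`. There are `c > 0` and `C₀` such that for
every period `N = k + 1 + n' + 1`, every separation `n' + 1 ≤ N/2` (i.e. `n' ≤ k`) and all bounded
measurable one-site observables `F`, `G`, the normalised connected correlation of `F` at site `0`
and `G` at site `n' + 1` in the Gibbs state with periodic weight `∏_t K(V t, V (t+1))` satisfies
`|⟨F G⟩ − ⟨F⟩⟨G⟩| ≤ C₀ ‖F‖_∞ ‖G‖_∞ e^{−c (n'+1)}`, with `c = log(λ/θ)` the spectral gap of the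
transfer operator (Jentzsch) — the constant does NOT depend on the period. (Trace formula
`KernelCyclicPeeling` + rank-one asymptotics `exists_iterate_spectral_bound`; small periods, where
the vacuum term does not yet dominate the partition function, are absorbed by the a-priori bound
`|⟨FG⟩ − ⟨F⟩⟨G⟩| ≤ 2‖F‖_∞‖G‖_∞`.) [folklore] -/
theorem exists_cyclic_clustering (hK : StronglyMeasurable (uncurry K)) (hC : ∀ x y, ‖K x y‖ ≤ C)
    (hsymm : ∀ x y, K x y = K y x) (hpos : ∀ x y, 0 < K x y) :
    ∃ c C₀ : ℝ, 0 < c ∧ 0 ≤ C₀ ∧ ∀ (k n' : ℕ), n' ≤ k → ∀ (p : Fin (k + 1 + n' + 1)),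
      (p : ℕ) = n' + 1 → ∀ (F G : X → ℝ), Measurable F → Measurable G → ∀ (BF BG : ℝ),
      (∀ x, ‖F x‖ ≤ BF) → (∀ x, ‖G x‖ ≤ BG) →
      |(∫ V, F (V 0) * G (V p) * ∏ t, K (V t) (V (t + 1))
              ∂(Measure.pi fun _ : Fin (k + 1 + n' + 1) => μ)) /
            (∫ V, ∏ t, K (V t) (V (t + 1)) ∂(Measure.pi fun _ : Fin (k + 1 + n' + 1) => μ)) -
          (∫ V, F (V 0) * ∏ t, K (V t) (V (t + 1))
                ∂(Measure.pi fun _ : Fin (k + 1 + n' + 1) => μ)) /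
              (∫ V, ∏ t, K (V t) (V (t + 1)) ∂(Measure.pi fun _ : Fin (k + 1 + n' + 1) => μ)) *
            ((∫ V, G (V p) * ∏ t, K (V t) (V (t + 1))
                ∂(Measure.pi fun _ : Fin (k + 1 + n' + 1) => μ)) /
              (∫ V, ∏ t, K (V t) (V (t + 1)) ∂(Measure.pi fun _ : Fin (k + 1 + n' + 1) => μ)))| ≤
        C₀ * BF * BG * Real.exp (-(c * (n' + 1))) := by
  obtain ⟨lam, θ, Cs, Bφ, φ₀, hθ0, hθlam, hCs0, hφ₀m, hφ₀b, hnorm, hins, hvac⟩ :=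
    exists_iterate_spectral_bound (μ := μ) hK hC hsymm hpos
  have hlam0 : 0 < lam := hθ0.trans hθlam
  set ρ : ℝ := θ / lam with hρ
  have hρ0 : 0 < ρ := div_pos hθ0 hlam0
  have hρ1 : ρ < 1 := (div_lt_one hlam0).2 hθlam
  have hθρ : θ = ρ * lam := by rw [hρ, div_mul_cancel₀ _ hlam0.ne']
  set c : ℝ := Real.log (lam / θ) with hc
  have hc0 : 0 < c := Real.log_pos ((one_lt_div hθ0).2 hθlam)
  have hexp : ∀ m : ℕ, Real.exp (-(c * m)) = ρ ^ m := fun m => by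
    rw [Real.exp_neg, hc, mul_comm, Real.exp_nat_mul, Real.exp_log (div_pos hlam0 hθ0), hρ,
      ← inv_pow, inv_div]
  set D : ℝ := 3 * Cs ^ 2 / lam ^ 2 with hD
  have hD0 : 0 ≤ D := by positivity
  refine ⟨c, (16 * D + 8 * D ^ 2) / ρ + 4 * Cs ^ 2 / lam ^ 2 / ρ, hc0, by positivity, ?_⟩
  intro k n' hnk p hp F G hF hG BF BG hFb hGb
  have hexp' : Real.exp (-(c * (n' + 1))) = ρ ^ (n' + 1) := by exact_mod_cast hexp (n' + 1)
  rw [hexp']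
  -- signs
  have huniv : μ univ ≠ 0 := by simp [measure_univ]
  obtain ⟨x₀, -⟩ := nonempty_of_measure_ne_zero huniv
  have hBF : 0 ≤ BF := (norm_nonneg _).trans (hFb x₀)
  have hBG : 0 ≤ BG := (norm_nonneg _).trans (hGb x₀)
  have hC0 : 0 ≤ C := (norm_nonneg _).trans (hC x₀ x₀)
  have hBφ : 0 ≤ Bφ := (norm_nonneg _).trans (hφ₀b x₀)
  /- ### path-integral side: positivity and a-priori bounds -/
  set pi : Measure (Fin (k + 1 + n' + 1) → X) := Measure.pi fun _ => μ with hpi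
  have hKm : Measurable (uncurry K) := hK.measurable
  have hPm : Measurable fun V : Fin (k + 1 + n' + 1) → X => ∏ t, K (V t) (V (t + 1)) := by
    refine Finset.measurable_prod _ fun t _ => ?_
    have h := hKm.comp ((measurable_pi_apply (X := fun _ : Fin (k + 1 + n' + 1) => X) t).prodMk
      (measurable_pi_apply (X := fun _ : Fin (k + 1 + n' + 1) => X) (t + 1)))
    exact h
  have hPpos : ∀ V : Fin (k + 1 + n' + 1) → X, 0 < ∏ t, K (V t) (V (t + 1)) := fun V =>
    Finset.prod_pos fun t _ => hpos _ _
  have hPb : ∀ V : Fin (k + 1 + n' + 1) → X, ‖∏ t, K (V t) (V (t + 1))‖ ≤ C ^ (k + 1 + n' + 1) :=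
    fun V => by
    calc ‖∏ t, K (V t) (V (t + 1))‖ ≤ ∏ t, ‖K (V t) (V (t + 1))‖ := Finset.norm_prod_le _ _
      _ ≤ ∏ _t : Fin (k + 1 + n' + 1), C :=
          Finset.prod_le_prod (fun t _ => norm_nonneg _) fun t _ => hC _ _
      _ = C ^ (k + 1 + n' + 1) := by simp
  have hPi : Integrable (fun V : Fin (k + 1 + n' + 1) → X => ∏ t, K (V t) (V (t + 1))) pi :=
    Integrable.of_bound hPm.aestronglyMeasurable _ (Eventually.of_forall hPb)
  have hZpos : 0 < ∫ V, ∏ t, K (V t) (V (t + 1)) ∂pi :=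
    integral_pos_of_ae_pos (IsProbabilityMeasure.ne_zero pi) hPi (Eventually.of_forall hPpos)
  have hapr : ∀ {F' G' : X → ℝ} {BF' BG' : ℝ}, Measurable F' → Measurable G' →
      (∀ x, ‖F' x‖ ≤ BF') → (∀ x, ‖G' x‖ ≤ BG') → 0 ≤ BF' → 0 ≤ BG' →
      |∫ V, F' (V 0) * G' (V p) * ∏ t, K (V t) (V (t + 1)) ∂pi| ≤
        BF' * BG' * ∫ V, ∏ t, K (V t) (V (t + 1)) ∂pi := by
    intro F' G' BF' BG' hF' hG' hF'b hG'b hBF' hBG'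
    rw [← Real.norm_eq_abs, ← integral_const_mul]
    refine norm_integral_le_of_norm_le (hPi.const_mul _) (Eventually.of_forall fun V => ?_)
    rw [norm_mul, norm_mul, Real.norm_of_nonneg (hPpos V).le]
    exact mul_le_mul_of_nonneg_right (mul_le_mul (hF'b _) (hG'b _) (norm_nonneg _) hBF') (hPpos V).le
  have hIFG := hapr hF hG hFb hGb hBF hBG
  have hIF1 := hapr hF measurable_const hFb (G' := fun _ => (1 : ℝ)) (BG' := 1) (fun _ => by simp)
    hBF zero_le_one
  have hI1G := hapr measurable_const hG (F' := fun _ => (1 : ℝ)) (BF' := 1) (fun _ => by simp) hGb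
    zero_le_one hBG
  simp only [mul_one, one_mul] at hIF1 hI1G
  /- ### spectral side: the four trace formulas and their rank-one asymptotics -/
  have eFG := integral_cyclic_eq_integral_iterate_symm (μ := μ) hKm hC hsymm k n' hF hG hFb hGb p hp
  have eF1 := integral_cyclic_eq_integral_iterate_symm (μ := μ) hKm hC hsymm k n' hF
    measurable_const hFb (G := fun _ => (1 : ℝ)) (BG := 1) (fun _ => by simp) p hp
  have e1G := integral_cyclic_eq_integral_iterate_symm (μ := μ) hKm hC hsymm k n'
    measurable_const hG (F := fun _ => (1 : ℝ)) (BF := 1) (fun _ => by simp) hGb p hp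
  have e11 := integral_cyclic_eq_integral_iterate_symm (μ := μ) hKm hC hsymm k n'
    measurable_const measurable_const (F := fun _ => (1 : ℝ)) (BF := 1) (G := fun _ => (1 : ℝ))
    (BG := 1) (fun _ => by simp) (fun _ => by simp) p hp
  simp only [one_mul, mul_one] at eF1 e1G e11
  rw [← hpi] at eFG eF1 e1G e11
  rw [eFG, eF1, e1G, e11]
  -- move the a-priori bounds to the spectral form
  rw [eFG, e11] at hIFG
  rw [eF1, e11] at hIF1
  rw [e1G, e11] at hI1G
  rw [e11] at hZpos
  -- the scales
  set L : ℝ := lam ^ (n' + k + 2) with hL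
  have hL0 : 0 < L := pow_pos hlam0 _
  set aF : ℝ := ∫ x, F x * φ₀ x ^ 2 ∂μ with haF
  set aG : ℝ := ∫ x, G x * φ₀ x ^ 2 ∂μ with haG
  set E : ℝ := Cs ^ 2 * (lam ^ n' * θ ^ k + lam ^ k * θ ^ n' + θ ^ (n' + k)) with hE
  set E₀ : ℝ := Cs ^ 2 * θ ^ (n' + k) with hE₀
  -- pointwise asymptotics (by definitional unfolding of the scales), then freeze the scales
  have hJ : ∀ x, |(fun f : X → ℝ => fun w => ∫ z, K w z * f z ∂μ)^[n' + 1]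
        (fun y => G y * (fun f : X → ℝ => fun w => ∫ z, K w z * f z ∂μ)^[k] (K x) y) x -
        L * φ₀ x ^ 2 * aG| ≤ BG * E := fun x => by
    have h := hins G hG BG hGb k n' x
    rw [hE, ← mul_assoc]
    exact h
  have hJ₁ : ∀ x, |(fun f : X → ℝ => fun w => ∫ z, K w z * f z ∂μ)^[n' + 1]
        (fun y => (fun f : X → ℝ => fun w => ∫ z, K w z * f z ∂μ)^[k] (K x) y) x -
        L * φ₀ x ^ 2| ≤ E₀ := fun x => hvac k n' x
  clear_value L aF aG E E₀
  have hE₀0 : 0 ≤ E₀ := by rw [hE₀]; positivity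
  have hE₀E : E₀ ≤ E := by
    rw [hE, hE₀]
    refine mul_le_mul_of_nonneg_left ?_ (sq_nonneg _)
    have h1 : 0 ≤ lam ^ n' * θ ^ k := by positivity
    have h2 : 0 ≤ lam ^ k * θ ^ n' := by positivity
    linarith
  have hE0 : 0 ≤ E := hE₀0.trans hE₀E
  -- |aF| ≤ BF, |aG| ≤ BG
  have hφ2i : Integrable (fun x => φ₀ x ^ 2) μ :=
    Integrable.of_bound (hφ₀m.pow_const 2).aestronglyMeasurable (Bφ ^ 2)
      (Eventually.of_forall fun x => by
        rw [norm_pow]; exact pow_le_pow_left₀ (norm_nonneg _) (hφ₀b x) 2)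
  have hα : ∀ {F' : X → ℝ} {BF' : ℝ}, (∀ x, ‖F' x‖ ≤ BF') →
      |∫ x, F' x * φ₀ x ^ 2 ∂μ| ≤ BF' := by
    intro F' BF' hF'b
    rw [← Real.norm_eq_abs]
    calc ‖∫ x, F' x * φ₀ x ^ 2 ∂μ‖ ≤ ∫ x, BF' * φ₀ x ^ 2 ∂μ :=
          norm_integral_le_of_norm_le (hφ2i.const_mul _) (Eventually.of_forall fun x => by
            rw [norm_mul, Real.norm_of_nonneg (sq_nonneg (φ₀ x))]
            exact mul_le_mul_of_nonneg_right (hF'b x) (sq_nonneg _))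
      _ = BF' := by rw [integral_const_mul, hnorm, mul_one]
  have haFb : |aF| ≤ BF := by rw [haF]; exact hα hFb
  have haGb : |aG| ≤ BG := by rw [haG]; exact hα hGb
  -- measurability and size of the two-arc integrands and of the main terms
  have hJm := measurable_iterate_obs_iterate_section (μ := μ) hK hG (n' + 1) k
  have hJ₁m := measurable_iterate_iterate_section (μ := μ) hK (n' + 1) k
  have hMm : Measurable fun x => L * φ₀ x ^ 2 * aG :=
    ((hφ₀m.pow_const 2).const_mul L).mul_const aG
  have hM₁m : Measurable fun x => L * φ₀ x ^ 2 := (hφ₀m.pow_const 2).const_mul L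
  have hMb : ∀ x, ‖L * φ₀ x ^ 2 * aG‖ ≤ L * Bφ ^ 2 * BG := fun x => by
    rw [norm_mul, norm_mul, Real.norm_of_nonneg hL0.le, norm_pow, Real.norm_eq_abs aG]
    exact mul_le_mul (mul_le_mul_of_nonneg_left (pow_le_pow_left₀ (norm_nonneg _) (hφ₀b x) 2)
      hL0.le) haGb (abs_nonneg _) (by positivity)
  have hM₁b : ∀ x, ‖L * φ₀ x ^ 2‖ ≤ L * Bφ ^ 2 := fun x => by
    rw [norm_mul, Real.norm_of_nonneg hL0.le, norm_pow]
    exact mul_le_mul_of_nonneg_left (pow_le_pow_left₀ (norm_nonneg _) (hφ₀b x) 2) hL0.le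
  -- integrate the pointwise asymptotics
  have hmainFG : ∫ x, F x * (L * φ₀ x ^ 2 * aG) ∂μ = L * aF * aG := by
    calc ∫ x, F x * (L * φ₀ x ^ 2 * aG) ∂μ = ∫ x, (L * aG) * (F x * φ₀ x ^ 2) ∂μ :=
          integral_congr_ae (Eventually.of_forall fun x => by ring)
      _ = L * aF * aG := by rw [integral_const_mul, ← haF]; ring
  have hmainF1 : ∫ x, F x * (L * φ₀ x ^ 2) ∂μ = L * aF := by
    calc ∫ x, F x * (L * φ₀ x ^ 2) ∂μ = ∫ x, L * (F x * φ₀ x ^ 2) ∂μ :=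
          integral_congr_ae (Eventually.of_forall fun x => by ring)
      _ = L * aF := by rw [integral_const_mul, ← haF]
  have hmain1G : ∫ x, (1 : ℝ) * (L * φ₀ x ^ 2 * aG) ∂μ = L * aG := by
    calc ∫ x, (1 : ℝ) * (L * φ₀ x ^ 2 * aG) ∂μ = ∫ x, (L * aG) * φ₀ x ^ 2 ∂μ :=
          integral_congr_ae (Eventually.of_forall fun x => by ring)
      _ = L * aG := by rw [integral_const_mul, hnorm, mul_one]
  have hmain11 : ∫ x, (1 : ℝ) * (L * φ₀ x ^ 2) ∂μ = L := by
    calc ∫ x, (1 : ℝ) * (L * φ₀ x ^ 2) ∂μ = ∫ x, L * φ₀ x ^ 2 ∂μ :=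
          integral_congr_ae (Eventually.of_forall fun x => by ring)
      _ = L := by rw [integral_const_mul, hnorm, mul_one]
  have h₁ := abs_integral_mul_sub_integral_mul_le (μ := μ) hF hJm hMm hFb hMb hJ
  have h₂ := abs_integral_mul_sub_integral_mul_le (μ := μ) hF hJ₁m hM₁m hFb hM₁b hJ₁
  have h₃ := abs_integral_mul_sub_integral_mul_le (μ := μ) (F := fun _ => (1 : ℝ)) measurable_const
    hJm hMm (BF := 1) (fun _ => by simp) hMb hJ
  have h₄ := abs_integral_mul_sub_integral_mul_le (μ := μ) (F := fun _ => (1 : ℝ)) measurable_const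
    hJ₁m hM₁m (BF := 1) (fun _ => by simp) hM₁b hJ₁
  rw [hmainFG, ← mul_assoc] at h₁
  rw [hmainF1] at h₂
  rw [hmain1G, one_mul] at h₃
  rw [hmain11, one_mul] at h₄
  simp only [one_mul] at h₃ h₄
  /- ### the two regimes -/
  have hρk : ρ ^ k ≤ ρ ^ n' := pow_le_pow_of_le_one hρ0.le hρ1.le hnk
  have hρnk : ρ ^ (n' + k) ≤ ρ ^ n' := pow_le_pow_of_le_one hρ0.le hρ1.le (Nat.le_add_right _ _)
  have hρn1 : ρ ^ n' ≤ 1 := pow_le_one₀ hρ0.le hρ1.le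
  have hCρ : ((16 * D + 8 * D ^ 2) / ρ + 4 * Cs ^ 2 / lam ^ 2 / ρ) * BF * BG * ρ ^ (n' + 1) =
      ((16 * D + 8 * D ^ 2) + 4 * Cs ^ 2 / lam ^ 2) * (BF * BG) * ρ ^ n' := by
    have hρne : ρ ≠ 0 := hρ0.ne'
    field_simp
    ring
  rw [hCρ]
  rcases le_or_gt E₀ (L / 2) with hcase | hcase
  · -- large periods: perturbation around the rank-one (vacuum) term
    have key := abs_div_sub_div_mul_div_le_of_approx hL0 hcase hE₀E hBF hBG haFb haGb h₁ h₂ h₃ h₄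
    refine key.trans ?_
    have hEL : E / L ≤ D * ρ ^ n' := by
      rw [div_le_iff₀ hL0]
      have h1 : E = Cs ^ 2 * lam ^ (n' + k) * (ρ ^ k + ρ ^ n' + ρ ^ (n' + k)) := by
        rw [hE, hθρ]; ring
      have h2 : D * ρ ^ n' * L = Cs ^ 2 * lam ^ (n' + k) * (3 * ρ ^ n') := by
        rw [hD, hL]; field_simp; ring
      rw [h1, h2]
      refine mul_le_mul_of_nonneg_left ?_ (by positivity)
      linarith
    have hEL0 : 0 ≤ E / L := div_nonneg hE0 hL0.le
    have hEL2 : (E / L) ^ 2 ≤ D ^ 2 * ρ ^ n' := by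
      calc (E / L) ^ 2 ≤ (D * ρ ^ n') ^ 2 := pow_le_pow_left₀ hEL0 hEL 2
        _ = D ^ 2 * (ρ ^ n' * ρ ^ n') := by ring
        _ ≤ D ^ 2 * (ρ ^ n' * 1) := by gcongr
        _ = D ^ 2 * ρ ^ n' := by ring
    have hBB : 0 ≤ BF * BG := mul_nonneg hBF hBG
    calc 16 * (BF * BG) * (E / L) + 8 * (BF * BG) * (E / L) ^ 2
        ≤ 16 * (BF * BG) * (D * ρ ^ n') + 8 * (BF * BG) * (D ^ 2 * ρ ^ n') := by gcongr
      _ = (16 * D + 8 * D ^ 2) * (BF * BG) * ρ ^ n' := by ring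
      _ ≤ ((16 * D + 8 * D ^ 2) + 4 * Cs ^ 2 / lam ^ 2) * (BF * BG) * ρ ^ n' := by
          have h0 : 0 ≤ 4 * Cs ^ 2 / lam ^ 2 * (BF * BG) * ρ ^ n' :=
            mul_nonneg (mul_nonneg (by positivity) hBB) (pow_nonneg hρ0.le _)
          linarith [h0, show ((16 * D + 8 * D ^ 2) + 4 * Cs ^ 2 / lam ^ 2) * (BF * BG) * ρ ^ n' =
            (16 * D + 8 * D ^ 2) * (BF * BG) * ρ ^ n' + 4 * Cs ^ 2 / lam ^ 2 * (BF * BG) * ρ ^ n'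
            by ring]
  · -- small periods: a-priori bound
    have hap := abs_div_sub_div_mul_div_le hZpos hIFG hIF1 hI1G
    refine hap.trans ?_
    -- from `L/2 < E₀`: `λ²/2 < Cₛ² ρ^{n'+k} ≤ Cₛ² ρ^{n'}`
    have h1 : lam ^ 2 / 2 * lam ^ (n' + k) < Cs ^ 2 * ρ ^ (n' + k) * lam ^ (n' + k) := by
      have h := hcase
      rw [hL, hE₀, hθρ, mul_pow] at h
      calc lam ^ 2 / 2 * lam ^ (n' + k) = lam ^ (n' + k + 2) / 2 := by ring
        _ < Cs ^ 2 * (ρ ^ (n' + k) * lam ^ (n' + k)) := h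
        _ = Cs ^ 2 * ρ ^ (n' + k) * lam ^ (n' + k) := by ring
    have h2 : lam ^ 2 / 2 < Cs ^ 2 * ρ ^ (n' + k) :=
      lt_of_mul_lt_mul_right h1 (pow_nonneg hlam0.le _)
    have h3 : lam ^ 2 / 2 < Cs ^ 2 * ρ ^ n' :=
      h2.trans_le (mul_le_mul_of_nonneg_left hρnk (sq_nonneg _))
    have h4 : 2 ≤ 4 * Cs ^ 2 / lam ^ 2 * ρ ^ n' := by
      rw [div_mul_eq_mul_div, le_div_iff₀ (pow_pos hlam0 2)]
      linarith
    have hBB : 0 ≤ BF * BG := mul_nonneg hBF hBG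
    calc 2 * (BF * BG) ≤ (4 * Cs ^ 2 / lam ^ 2 * ρ ^ n') * (BF * BG) :=
          mul_le_mul_of_nonneg_right h4 hBB
      _ = 4 * Cs ^ 2 / lam ^ 2 * (BF * BG) * ρ ^ n' := by ring
      _ ≤ ((16 * D + 8 * D ^ 2) + 4 * Cs ^ 2 / lam ^ 2) * (BF * BG) * ρ ^ n' := by
          have h0 : 0 ≤ (16 * D + 8 * D ^ 2) * (BF * BG) * ρ ^ n' :=
            mul_nonneg (mul_nonneg (by positivity) hBB) (pow_nonneg hρ0.le _)
          linarith [h0, show ((16 * D + 8 * D ^ 2) + 4 * Cs ^ 2 / lam ^ 2) * (BF * BG) * ρ ^ n' =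
            (16 * D + 8 * D ^ 2) * (BF * BG) * ρ ^ n' + 4 * Cs ^ 2 / lam ^ 2 * (BF * BG) * ρ ^ n'
            by ring]

/-- `exists_cyclic_clustering` with the cycle indexed by `ZMod N` (`N = k + 1 + n' + 1`; `ZMod N` is
`Fin N` and its `+ 1` is the cyclic successor), the insertion site given as `(n' + 1 : ZMod N)`.
This is the form produced by time-slicing a periodic lattice `ℤ_N × Λ`. [folklore] -/
theorem exists_cyclic_clustering_zmod (hK : StronglyMeasurable (uncurry K)) (hC : ∀ x y, ‖K x y‖ ≤ C)
    (hsymm : ∀ x y, K x y = K y x) (hpos : ∀ x y, 0 < K x y) :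
    ∃ c C₀ : ℝ, 0 < c ∧ 0 ≤ C₀ ∧ ∀ (k n' : ℕ), n' ≤ k → ∀ (F G : X → ℝ), Measurable F → Measurable G →
      ∀ (BF BG : ℝ), (∀ x, ‖F x‖ ≤ BF) → (∀ x, ‖G x‖ ≤ BG) →
      |(∫ V : ZMod (k + 1 + n' + 1) → X, F (V 0) * G (V ((n' + 1 : ℕ) : ZMod (k + 1 + n' + 1))) *
              ∏ t, K (V t) (V (t + 1)) ∂(Measure.pi fun _ => μ)) /
            (∫ V : ZMod (k + 1 + n' + 1) → X, ∏ t, K (V t) (V (t + 1)) ∂(Measure.pi fun _ => μ)) -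
          (∫ V : ZMod (k + 1 + n' + 1) → X, F (V 0) * ∏ t, K (V t) (V (t + 1))
                ∂(Measure.pi fun _ => μ)) /
              (∫ V : ZMod (k + 1 + n' + 1) → X, ∏ t, K (V t) (V (t + 1)) ∂(Measure.pi fun _ => μ)) *
            ((∫ V : ZMod (k + 1 + n' + 1) → X, G (V ((n' + 1 : ℕ) : ZMod (k + 1 + n' + 1))) *
                ∏ t, K (V t) (V (t + 1)) ∂(Measure.pi fun _ => μ)) /
              (∫ V : ZMod (k + 1 + n' + 1) → X, ∏ t, K (V t) (V (t + 1)) ∂(Measure.pi fun _ => μ)))| ≤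
        C₀ * BF * BG * Real.exp (-(c * (n' + 1))) := by
  obtain ⟨c, C₀, hc, hC₀, h⟩ := exists_cyclic_clustering (μ := μ) hK hC hsymm hpos
  refine ⟨c, C₀, hc, hC₀, fun k n' hnk F G hF hG BF BG hFb hGb => ?_⟩
  have hp : ((show Fin (k + 1 + n' + 1) from ((n' + 1 : ℕ) : ZMod (k + 1 + n' + 1))) : ℕ) = n' + 1 := by
    show ZMod.val ((↑(n' + 1) : ZMod (k + 1 + n' + 1))) = n' + 1
    rw [ZMod.val_natCast]
    exact Nat.mod_eq_of_lt (by omega)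
  exact h k n' hnk _ hp F G hF hG BF BG hFb hGb

end Clustering

end Literature.Analysis.OperatorTheory

end
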